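import Mathlib
import Summits.Ventures.HodgeRepro.Tier4.Line1.RTFSetting
import Summits.Ventures.HodgeRepro.Tier4.Line1.RtfUnfold
import Summits.Ventures.HodgeRepro.Tier4.Line1.RtfSpectralStep

/-!
# Tier4/Line1/PairOrbitalWindow — LINE L1, towards J2.c′: the phase on the orbit, the compactness step, the window

Blind re-derivation cell `pub-hodge-repro`, Tier 4 «prove the step» (README §9–§10), seat t4-L1-p4 (prover, gen 0;
lead S12295: t4-L1-p4 = J2.c′ `exists_pair_orbital_ne_zero`, Skeleton v0.10 3d8356354c198ec9 L531–L538 = v0.11).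
LINE L1 = the relative-trace-formula line of t4-plan-1; generic layer `Tier4/Line1/RTFSetting.lean` (plan-1),
`Tier4/Line1/RtfUnfold.lean` and `Tier4/Line1/RtfSpectralStep.lean` (t4-L1-p4, L1.2b), imported BY NAME.
Paper proof and rung cut: proofs/t4/L1/J2c.md.  THE PLAN (a repair of the skeleton's docstring plan: NO conjugate
phase extension, NO Tietze, NO approximate identity): `f₁, f₂` are non-negative bumps at `γ₀`, `1`; `f = f₁ ⋆ f₂ ≥ 0`
is a test function positive near `γ₀` and supported in a small open `V ∋ γ₀`; on `DT × DT′` only finitely many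
orbit elements contribute and, by a compactness argument (`exists_open_phase_re_gt`), every contributing phase
`χ(t) conj χ′(t′)` has real part `> 1/2` once `V` is small, so `Re (orbital f) ≥ ½ ∫∫ ∑_γ f(t⁻¹γt′) > 0`
(`orbitSum_integral_pos`: rational translates + `[Countable Gk]`).

This module (2 of 4): R6″ `IsCharacter.mul_rational` / `IsCharacter'.mul_rational` (rational invariance of the
characters), `phase_eq_one_of_fixed` (on the fibre over `γ₀` the phase is `1`: `hreg` + `CentralMatch` + `unit`),
R6 `exists_open_phase_re_gt` (THE COMPACTNESS STEP: for a compact `K ⊆ T × T′` an open `V ∋ γ₀` on which every phase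
over `K` has real part `> 1/2`), R6′ `finite_window` (only finitely many rational `γ` have
`(closure DT)⁻¹ γ (closure DT′)` meeting a compact), `partialKernel_eq_sum_window` / `orbitSum_eq_sum` / `orbitSum_summable`
(the orbit sums are finite sums on `closure DT × closure DT′`), R7a `exists_rational_translate_pos` (`[Countable Gk]`:
a set of positive measure has a rational translate meeting `DT` in positive measure), R7b `measure_image_mul_left_T`,
R9 `continuous_setIntegral_orbit_real`.

Nothing here says anything about the status of the Hodge conjecture for CM abelian varieties, which is NOT proved;
HC_CM is NOT proved by anyone in this repository.
-/

set_option autoImplicit false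

noncomputable section

namespace Summit.Ventures.HodgeRepro.Tier4.Line1

open MeasureTheory Topology Filter Set
open scoped Uniformity Pointwise InnerProductSpace ComplexConjugate

namespace RTF

variable {G : Type} [Group G] [TopologicalSpace G] [IsTopologicalGroup G] [MeasurableSpace G]
  [BorelSpace G]

namespace Setting

variable (S : Setting G)


omit [IsTopologicalGroup G] [BorelSpace G] in
/-- R6″: a character of `[T]` is invariant under left translation by rational points of `T`. -/
theorem IsCharacter.mul_rational {χ : S.T → ℂ} (hχ : S.IsCharacter χ) (δ : S.T)
    (hδ : (δ : G) ∈ S.Gk) (t : S.T) : χ (δ * t) = χ t := by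
  rw [hχ.map_mul, hχ.rational δ (Subgroup.mem_subgroupOf.mpr hδ), one_mul]

omit [IsTopologicalGroup G] [BorelSpace G] in
/-- R6″ for `T'`. -/
theorem IsCharacter'.mul_rational {χ' : S.T' → ℂ} (hχ' : S.IsCharacter' χ') (δ : S.T')
    (hδ : (δ : G) ∈ S.Gk) (t : S.T') : χ' (δ * t) = χ' t := by
  rw [hχ'.map_mul, hχ'.rational δ (Subgroup.mem_subgroupOf.mpr hδ), one_mul]

omit [IsTopologicalGroup G] [BorelSpace G] in
/-- on the fibre over `γ₀` the phase is `1`: if `t⁻¹ γ₀ t' = γ₀` then (regularity) `t ∈ Z`, `t' = t`, and the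
central match + unitarity give `χ t · conj χ' t' = |χ t|² = 1`. -/
theorem phase_eq_one_of_fixed {χ : S.T → ℂ} {χ' : S.T' → ℂ} (hχ : S.IsCharacter χ)
    (hZ : S.CentralMatch χ χ') (γ₀ : S.Gk)
    (hreg : ∀ t ∈ S.T, ∀ t' ∈ S.T', t⁻¹ * γ₀ * t' = γ₀ → t ∈ S.Z ∧ t' = t) (t : S.T) (t' : S.T')
    (h : (t : G)⁻¹ * γ₀ * t' = γ₀) : χ t * conj (χ' t') = 1 := by
  obtain ⟨hz, he⟩ := hreg t t.2 t' t'.2 h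
  have h1 : t = ⟨(t : G), S.ZleT hz⟩ := Subtype.ext rfl
  have h2 : t' = ⟨(t : G), S.ZleT' hz⟩ := Subtype.ext he
  rw [h2, ← hZ (t : G) hz, ← h1, RCLike.mul_conj, hχ.unit]
  norm_num

omit [BorelSpace G] in
/-- R6 (THE COMPACTNESS STEP): for a compact `K ⊆ T × T'` there is an open `V ∋ γ₀` such that every
`(s, s') ∈ K` with `s⁻¹ γ₀ s' ∈ V` has a phase of real part `> 1/2` (the set of points of `K` with phase
of real part `≤ 1/2` is compact, its image under the orbit map is closed and misses `γ₀`). -/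
theorem exists_open_phase_re_gt [T2Space G] {χ : S.T → ℂ} {χ' : S.T' → ℂ} (hχ : S.IsCharacter χ)
    (hχ' : S.IsCharacter' χ') (hZ : S.CentralMatch χ χ') (γ₀ : S.Gk)
    (hreg : ∀ t ∈ S.T, ∀ t' ∈ S.T', t⁻¹ * γ₀ * t' = γ₀ → t ∈ S.Z ∧ t' = t)
    {K : Set (S.T × S.T')} (hK : IsCompact K) :
    ∃ V : Set G, IsOpen V ∧ (γ₀ : G) ∈ V ∧
      ∀ p ∈ K, (p.1 : G)⁻¹ * γ₀ * p.2 ∈ V → 1 / 2 < (χ p.1 * conj (χ' p.2)).re := by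
  set m : S.T × S.T' → G := fun p => (p.1 : G)⁻¹ * γ₀ * p.2 with hm
  have hmc : Continuous m :=
    ((continuous_subtype_val.comp continuous_fst).inv.mul continuous_const).mul
      (continuous_subtype_val.comp continuous_snd)
  set B : Set (S.T × S.T') := K ∩ {p | (χ p.1 * conj (χ' p.2)).re ≤ 1 / 2} with hB
  have hBc : IsCompact B := by
    apply hK.inter_right
    apply isClosed_le _ continuous_const
    exact Complex.continuous_re.comp
      (((hχ.cont.comp continuous_fst)).mul (Complex.continuous_conj.comp (hχ'.cont.comp continuous_snd)))
  have himg : IsClosed (m '' B) := (hBc.image hmc).isClosed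
  refine ⟨(m '' B)ᶜ, himg.isOpen_compl, ?_, ?_⟩
  · rintro ⟨p, hpB, hpm⟩
    have h1 := S.phase_eq_one_of_fixed hχ hZ γ₀ hreg p.1 p.2 hpm
    have h2 := hpB.2
    simp only [Set.mem_setOf_eq] at h2
    rw [h1] at h2
    norm_num at h2
  · intro p hpK hpV
    by_contra hle
    apply hpV
    exact ⟨p, ⟨hpK, not_lt.mp hle⟩, rfl⟩

omit [BorelSpace G] in
/-- R6′ (the finite orbit window): for a compact `V₀ ⊆ G`, only finitely many rational `γ` have
`(closure DT)⁻¹ γ (closure DT') ∩ V₀ ≠ ∅`. -/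
theorem finite_window (V₀ : Set G) (hV₀ : IsCompact V₀) :
    {γ : S.Gk | ∃ t ∈ closure S.DT, ∃ t' ∈ closure S.DT', (t : G)⁻¹ * γ * t' ∈ V₀}.Finite := by
  have hC : IsCompact (((fun t : S.T => (t : G)) '' closure S.DT) * V₀ *
      ((fun t : S.T' => (t : G)) '' closure S.DT')⁻¹) :=
    (S.isCompact_image_closure_DT.mul hV₀).mul S.isCompact_image_closure_DT'.inv
  refine (S.finite_rational_inter hC).subset ?_
  rintro γ ⟨t, ht, t', ht', hV⟩
  refine ⟨(t : G) * ((t : G)⁻¹ * γ * t'), ⟨t, ⟨t, ht, rfl⟩, (t : G)⁻¹ * γ * t', hV, rfl⟩,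
    (t' : G)⁻¹, Set.inv_mem_inv.mpr ⟨t', ht', rfl⟩, ?_⟩
  group

omit [BorelSpace G] in
open scoped Classical in
/-- the orbit sum at `(t, t') ∈ closure DT × closure DT'` is a finite sum over the window `Γ`
(a test function `f` with `tsupport f ⊆ V₀`). -/
theorem partialKernel_eq_sum_window {f : G → ℂ} {V₀ : Set G} (hV₀ : IsCompact V₀) (hf : tsupport f ⊆ V₀)
    (o : S.Orbit) {t : S.T} (ht : t ∈ closure S.DT) {t' : S.T'} (ht' : t' ∈ closure S.DT') :
    S.partialKernel o f t t' =
      ∑ γ ∈ (S.finite_window V₀ hV₀).toFinset.subtype (fun γ => S.orbitOf γ = o),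
        f ((t : G)⁻¹ * γ.1 * t') := by
  unfold partialKernel
  apply tsum_eq_sum
  intro γ hγ
  by_contra hne
  apply hγ
  rw [Finset.mem_subtype, Set.Finite.mem_toFinset]
  exact ⟨t, ht, t', ht', hf (subset_tsupport f hne)⟩

omit [BorelSpace G] in
open scoped Classical in
/-- the real orbit sum at `(t, t') ∈ closure DT × closure DT'` is a finite sum over the window. -/
theorem orbitSum_eq_sum {c : G → ℝ} {V₀ : Set G} (hV₀ : IsCompact V₀) (hc : tsupport c ⊆ V₀)
    (o : S.Orbit) {t : S.T} (ht : t ∈ closure S.DT) {t' : S.T'} (ht' : t' ∈ closure S.DT') :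
    (∑' γ : {γ : S.Gk // S.orbitOf γ = o}, c ((t : G)⁻¹ * γ.1 * t')) =
      ∑ γ ∈ (S.finite_window V₀ hV₀).toFinset.subtype (fun γ => S.orbitOf γ = o),
        c ((t : G)⁻¹ * γ.1 * t') := by
  apply tsum_eq_sum
  intro γ hγ
  by_contra hne
  apply hγ
  rw [Finset.mem_subtype, Set.Finite.mem_toFinset]
  exact ⟨t, ht, t', ht', hc (subset_tsupport c hne)⟩

omit [BorelSpace G] in
open scoped Classical in
/-- the real orbit sum is summable at `(t, t') ∈ closure DT × closure DT'`. -/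
theorem orbitSum_summable {c : G → ℝ} {V₀ : Set G} (hV₀ : IsCompact V₀) (hc : tsupport c ⊆ V₀)
    (o : S.Orbit) {t : S.T} (ht : t ∈ closure S.DT) {t' : S.T'} (ht' : t' ∈ closure S.DT') :
    Summable fun γ : {γ : S.Gk // S.orbitOf γ = o} => c ((t : G)⁻¹ * γ.1 * t') := by
  apply summable_of_ne_finset_zero
    (s := (S.finite_window V₀ hV₀).toFinset.subtype (fun γ => S.orbitOf γ = o))
  intro γ hγ
  by_contra hne
  apply hγ
  rw [Finset.mem_subtype, Set.Finite.mem_toFinset]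
  exact ⟨t, ht, t', ht', hc (subset_tsupport c hne)⟩

omit [IsTopologicalGroup G] [BorelSpace G] in
/-- R7a (`[Countable Gk]`): a set `W ⊆ T` of positive measure has a rational translate `δ` with
`{x ∈ W | δ x ∈ DT}` of positive measure (the pieces cover `W` up to a null set, countably many). -/
theorem exists_rational_translate_pos [Countable S.Gk] {W : Set S.T} (hW : 0 < S.μT W) :
    ∃ δ : S.Gk.subgroupOf S.T, 0 < S.μT {x ∈ W | δ • x ∈ S.DT} := by
  haveI : Countable (S.Gk.subgroupOf S.T) := by
    refine Function.Injective.countable (f := fun d : S.Gk.subgroupOf S.T =>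
      (⟨((d : S.T) : G), Subgroup.mem_subgroupOf.mp d.2⟩ : S.Gk)) ?_
    intro a b hab
    have := congrArg Subtype.val hab
    exact Subtype.ext (Subtype.ext this)
  by_contra hcon
  have hall : ∀ δ : S.Gk.subgroupOf S.T, S.μT {x ∈ W | δ • x ∈ S.DT} = 0 := by
    intro δ
    by_contra hne
    exact hcon ⟨δ, pos_iff_ne_zero.mpr hne⟩
  have hU : S.μT (⋃ δ : S.Gk.subgroupOf S.T, {x ∈ W | δ • x ∈ S.DT}) = 0 :=
    measure_iUnion_null hall
  have hnull : S.μT {x : S.T | ¬ ∃ δ : S.Gk.subgroupOf S.T, δ • x ∈ S.DT} = 0 :=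
    ae_iff.mp S.fdT.ae_covers
  have hsub : W ⊆ (⋃ δ : S.Gk.subgroupOf S.T, {x ∈ W | δ • x ∈ S.DT}) ∪
      {x : S.T | ¬ ∃ δ : S.Gk.subgroupOf S.T, δ • x ∈ S.DT} := by
    intro x hx
    by_cases h : ∃ δ : S.Gk.subgroupOf S.T, δ • x ∈ S.DT
    · obtain ⟨δ, hδ⟩ := h
      exact Or.inl (Set.mem_iUnion.mpr ⟨δ, hx, hδ⟩)
    · exact Or.inr h
  have := measure_mono_null hsub (measure_union_null hU hnull)
  exact hW.ne' this

omit [IsTopologicalGroup G] [BorelSpace G] in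
/-- R7a for `T'`. -/
theorem exists_rational_translate_pos' [Countable S.Gk] {W : Set S.T'} (hW : 0 < S.μT' W) :
    ∃ δ : S.Gk.subgroupOf S.T', 0 < S.μT' {x ∈ W | δ • x ∈ S.DT'} := by
  haveI : Countable (S.Gk.subgroupOf S.T') := by
    refine Function.Injective.countable (f := fun d : S.Gk.subgroupOf S.T' =>
      (⟨((d : S.T') : G), Subgroup.mem_subgroupOf.mp d.2⟩ : S.Gk)) ?_
    intro a b hab
    have := congrArg Subtype.val hab
    exact Subtype.ext (Subtype.ext this)
  by_contra hcon
  have hall : ∀ δ : S.Gk.subgroupOf S.T', S.μT' {x ∈ W | δ • x ∈ S.DT'} = 0 := by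
    intro δ
    by_contra hne
    exact hcon ⟨δ, pos_iff_ne_zero.mpr hne⟩
  have hU : S.μT' (⋃ δ : S.Gk.subgroupOf S.T', {x ∈ W | δ • x ∈ S.DT'}) = 0 :=
    measure_iUnion_null hall
  have hnull : S.μT' {x : S.T' | ¬ ∃ δ : S.Gk.subgroupOf S.T', δ • x ∈ S.DT'} = 0 :=
    ae_iff.mp S.fdT'.ae_covers
  have hsub : W ⊆ (⋃ δ : S.Gk.subgroupOf S.T', {x ∈ W | δ • x ∈ S.DT'}) ∪
      {x : S.T' | ¬ ∃ δ : S.Gk.subgroupOf S.T', δ • x ∈ S.DT'} := by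
    intro x hx
    by_cases h : ∃ δ : S.Gk.subgroupOf S.T', δ • x ∈ S.DT'
    · obtain ⟨δ, hδ⟩ := h
      exact Or.inl (Set.mem_iUnion.mpr ⟨δ, hx, hδ⟩)
    · exact Or.inr h
  have := measure_mono_null hsub (measure_union_null hU hnull)
  exact hW.ne' this

/-- R7b: left translation by an element of `T` preserves `μT` on images. -/
theorem measure_image_mul_left_T (d : S.T) (B : Set S.T) :
    S.μT ((fun x : S.T => d * x) '' B) = S.μT B := by
  haveI := S.haarT
  have : (fun x : S.T => d * x) '' B = (fun x : S.T => d⁻¹ * x) ⁻¹' B := by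
    ext x
    simp only [Set.mem_image, Set.mem_preimage]
    constructor
    · rintro ⟨y, hy, rfl⟩
      simpa using hy
    · intro hx
      exact ⟨d⁻¹ * x, hx, by simp⟩
  rw [this, measure_preimage_mul]

/-- R7b for `T'`. -/
theorem measure_image_mul_left_T' (d : S.T') (B : Set S.T') :
    S.μT' ((fun x : S.T' => d * x) '' B) = S.μT' B := by
  haveI := S.haarT'
  have : (fun x : S.T' => d * x) '' B = (fun x : S.T' => d⁻¹ * x) ⁻¹' B := by
    ext x
    simp only [Set.mem_image, Set.mem_preimage]
    constructor
    · rintro ⟨y, hy, rfl⟩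
      simpa using hy
    · intro hx
      exact ⟨d⁻¹ * x, hx, by simp⟩
  rw [this, measure_preimage_mul]

/-- R9 (real version): `t ↦ ∫_{DT'} c(t⁻¹ γ t')` is continuous on `T` for a continuous compactly supported
real `c`. -/
theorem continuous_setIntegral_orbit_real {c : G → ℝ} (hc : Continuous c) (hcs : HasCompactSupport c)
    (γ : G) : Continuous fun t : S.T => ∫ t' in S.DT', c ((t : G)⁻¹ * γ * t') ∂S.μT' := by
  haveI := S.haarT'
  letI : UniformSpace G := IsTopologicalGroup.rightUniformSpace G
  have huc : UniformContinuous c := hcs.uniformContinuous_of_continuous hc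
  rw [continuous_iff_continuousAt]
  intro t₀
  rw [ContinuousAt, Metric.tendsto_nhds]
  intro ε hε
  set I : ℝ := S.μT'.real S.DT' with hI
  have hI0 : 0 ≤ I := measureReal_nonneg
  set δ : ℝ := ε / (2 * (I + 1)) with hδ
  have hδpos : 0 < δ := by positivity
  have hent : {p : G × G | dist (c p.1) (c p.2) < δ} ∈ 𝓤 G :=
    huc (Metric.dist_mem_uniformity hδpos)
  rw [uniformity_eq_comap_nhds_one' G, Filter.mem_comap] at hent
  obtain ⟨U, hU, hUsub⟩ := hent
  have hV : {t : S.T | (t : G)⁻¹ * t₀ ∈ U} ∈ 𝓝 t₀ := by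
    have hcont : Continuous fun t : S.T => (t : G)⁻¹ * (t₀ : G) :=
      (continuous_subtype_val.inv).mul continuous_const
    exact hcont.continuousAt.preimage_mem_nhds (by rw [inv_mul_cancel]; exact hU)
  filter_upwards [hV] with t ht
  have hdiff : ∀ t' : S.T', ‖c ((t : G)⁻¹ * γ * t') - c ((t₀ : G)⁻¹ * γ * t')‖ ≤ δ := by
    intro t'
    have hmem : ((t₀ : G)⁻¹ * γ * t', (t : G)⁻¹ * γ * t') ∈
        (fun p : G × G => p.2 * p.1⁻¹) ⁻¹' U := by
      simp only [Set.mem_preimage, mul_inv_rev, inv_inv]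
      convert ht using 1
      group
    have := hUsub hmem
    simp only [Set.mem_setOf_eq, dist_eq_norm] at this
    rw [norm_sub_rev]
    exact this.le
  have hfin : IsFiniteMeasure (S.μT'.restrict S.DT') := isFiniteMeasure_restrict.mpr S.measure_DT'_ne_top
  have hi : ∀ s : S.T, IntegrableOn (fun t' : S.T' => c ((s : G)⁻¹ * γ * t')) S.DT' S.μT' := by
    intro s
    obtain ⟨C, hC⟩ := hc.bounded_above_of_compact_support hcs
    refine Integrable.mono' (integrable_const C) ?_ (Eventually.of_forall fun t' => hC _)
    exact (hc.comp (continuous_const.mul continuous_subtype_val)).aestronglyMeasurable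
  rw [dist_eq_norm, ← integral_sub (hi t) (hi t₀)]
  calc ‖∫ t' in S.DT', (c ((t : G)⁻¹ * γ * t') - c ((t₀ : G)⁻¹ * γ * t')) ∂S.μT'‖
      ≤ ∫ t' in S.DT', ‖c ((t : G)⁻¹ * γ * t') - c ((t₀ : G)⁻¹ * γ * t')‖ ∂S.μT' :=
        norm_integral_le_integral_norm _
    _ ≤ ∫ _t' in S.DT', δ ∂S.μT' := by
        apply integral_mono_of_nonneg (Eventually.of_forall fun _ => norm_nonneg _) (integrable_const δ)
        exact Eventually.of_forall fun t' => hdiff t'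
    _ = δ * I := by rw [setIntegral_const, smul_eq_mul, mul_comm]
    _ < ε := by
        rw [hδ]
        have : ε / (2 * (I + 1)) * I < ε / (2 * (I + 1)) * (2 * (I + 1)) :=
          mul_lt_mul_of_pos_left (by linarith) (by positivity)
        rw [div_mul_cancel₀ _ (by positivity)] at this
        exact this

end Setting

end RTF

end Summit.Ventures.HodgeRepro.Tier4.Line1
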